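import Summits.BirchSwinnertonDyer.BirchSwinnertonDyer.Theorems.BiquadraticEisensteinDescentHeegnerTwistCouplingInSupplySymbolicMonskyOddDesignNegTwoTrivialDoor
import Summits.BirchSwinnertonDyer.BirchSwinnertonDyer.Theorems.BiquadraticEisensteinDescentHeegnerTwistCouplingInSupplySymbolicMonskyMuOneLaplacian
import HarnessLib

set_option linter.dupNamespace false -- `Summit.BirchSwinnertonDyer.BirchSwinnertonDyer.Theorems.…` (summit = sub)
set_option autoImplicit false

/-!
# Crux `HeegnerTwistCouplingInSupply` (stmt-BirchSwinnertonDyer-21381) — ODD bases with NO prime `≡ 5 (mod 8)`: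
# at `δ = 1` the `V × 0` section of the augmented kernel never obstructs (no «κ_u + ε» exceptional base in the class family `{1, 3, 7} (mod 8)`)

Route `BiquadraticEisensteinDescent` (cell `pub/bsd-wall`, width seat `bsd-wall-cm-bed-w3` g25; `--supports` 21381, helper). Odd twin of
`…SymbolicMonskyEvenDesignNoFive` and sequel of `…SymbolicMonskyOddDesignNoSeven` (w3 g25). Setting of `…SymbolicMonskyOddKernelParity`
(p752042): for a root-number-`−1` ODD base (`Σ_b ([P_b ≡ 3 (4)] + [(2/P_b) = −1]) = 1`, `hroot`) the odd THEOREM A needs, at `δ = 1`, the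
sections of `𝒦⁺(1) = 𝒦 ⊕ ⟨(1,1)⟩` with `V × 0` (h1), `0 × V` (h2) and the diagonal (h3) to have dimension `≤ τ₀ = (dim 𝒦 + 1)/2`. The common
odd exceptional class of memo THEOREM-A-w3g22 §5 («`κ_u + ε > τ₀`», (h1) fails; `odd_universality_fails`, p754806: base `(5,5,5)`) always carries
primes `≡ 5 (mod 8)`. This file proves that this is forced: on the family of odd bases WITHOUT a prime `≡ 5 (mod 8)` (`[(2/P_b) = −1] →
[(−1/P_b) = −1]`, classes `1, 3, 7 (mod 8)`, an odd number of them `≡ 7 (mod 8)`) condition (h1) holds at `δ = 1` for EVERY base; the family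
contains `{1,7}` (`…OddDesignNegTwoTrivial`, δ = 1 universal, every odd μ) and THEOREM B's μ = 1 bases without class 5.
* `swap_mem_augKernel_one_inf_ker_fst_of_noFive` — MECHANISM: if `(w, 0) ∈ 𝒦⁺(1)` with `⟨m + d, w⟩ = 0` then `(0, w) ∈ 𝒦⁺(1)`:
  `(w, 0) = (x, γ·1) + γ(1,1)` with `(x, γ·1) ∈ 𝒦`, whose equations read `x|_M = 0`, `Lx = γ d`; with `D ⊆ M` also `x|_D = 0`, so
  `⟨m + d, w⟩ = γ·Σ_b (m_b + d_b) = γ`, `γ = 0`, `w = x ∈ ker L`, and `(0, x) ∈ 𝒦`.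
* ★★ `two_mul_finrank_augKernel_one_inf_ker_snd_le_of_noFive` — hence `2·dim (𝒦⁺(1) ∩ V×0) ≤ dim 𝒦 + 1 = 2τ₀` (swap of the codimension-`≤ 1`
  part into the `0 × V` section, disjointness inside `𝒦⁺(1)` of dimension `dim 𝒦 + 1`, kernel parity `odd_finrank_virtualKernel`).
* ★★★ `exists_patternFree_design_one_of_noFive_odd` — two-condition odd door at `δ = 1` (`0 × V` and diagonal sections `≤ τ₀` ⇒ pattern-free
  Heegner recipe with `τ₀ + 1` auxiliary primes; the `0 × V` condition is the odd (★), numerically never violated, the diagonal one fails on the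
  rare «diagonal» class of memo EVEN-EXCEPTIONAL-CLASS-w3g24 §2f), and ★★★ `exists_recipe_cruxOn_odd_one_of_noFive` — the same through the
  realisation door `RealisesK.cruxOn_odd_of_BT_of_forall`, modulo Burungale–Tian.
HONEST FRAMING: RUNG-LEVEL corner layer (odd congruent `j = 1728` families `E_{n₀}`); `𝔽₂`-linear algebra attached to Monsky matrices
[cite: HeathBrown1994SelmerCongruentII, Appendix (Monsky), typescript pp. 39–41]; instances need located primes (w4 layer) and the print input
[cite: BurungaleTian2026, Thm. 1.1]; the crux as stated (C⁺), its registered stubs and BSD are NOT touched; nothing is closed. THEOREMS ONLY.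
-/

namespace Summit.BirchSwinnertonDyer.BirchSwinnertonDyer.Theorems.SymbolicMonsky

section NoFiveOdd

open Module Matrix Literature.NumberTheory.EllipticCurves Literature.NumberTheory.EllipticCurves.HeathBrown1994
  Literature.NumberTheory.EllipticCurves.HeathBrown1994.Families
open Literature.NumberTheory.EllipticCurves.Rank1Residual

variable {k : ℕ} (base : SymbData (k + 1))

/-- Cutting a subspace by one linear functional costs at most one dimension. -/
private theorem finrank_le_finrank_inf_ker_add_one_odd₅ {Z : Type*} [AddCommGroup Z] [Module (ZMod 2) Z] [FiniteDimensional (ZMod 2) Z]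
    (C : Submodule (ZMod 2) Z) (f : Z →ₗ[ZMod 2] ZMod 2) :
    finrank (ZMod 2) ↥C ≤ finrank (ZMod 2) ↥(C ⊓ LinearMap.ker f) + 1 := by
  have h1 := Submodule.finrank_sup_add_finrank_inf_eq C (LinearMap.ker f)
  have h2 := LinearMap.finrank_range_add_finrank_ker f
  have h3 : finrank (ZMod 2) ↥(LinearMap.range f) ≤ 1 := by
    have := Submodule.finrank_le (LinearMap.range f)
    rwa [Module.finrank_self] at this
  have h4 : finrank (ZMod 2) ↥(C ⊔ LinearMap.ker f) ≤ finrank (ZMod 2) Z := Submodule.finrank_le _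
  omega

/-- `δ = 1` is a legitimate odd design on a root-number-`−1` odd base: `(1, 1) ∉ 𝒦` (as in `…OddDesignNoSeven`). -/
private theorem one_one_not_mem_virtualKernel₅ (hroot : (∑ b, (bz (negNegOne (base.cls b)) + bz (negTwo (base.cls b)))) = 1) :
    ((fun _ => (1 : ZMod 2), fun _ => (1 : ZMod 2)) : (Fin (k + 1) → ZMod 2) × (Fin (k + 1) → ZMod 2)) ∉ base.virtualKernel := by
  intro h
  obtain ⟨hE1, -⟩ := (mem_virtualKernel_iff base _).1 h
  have e : ∀ i, bz (negNegOne (base.cls i)) + bz (negTwo (base.cls i)) = 0 := fun i => by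
    have := hE1 i
    simp only [mul_one, lap_const, zero_add] at this
    exact this
  have hs : (∑ b, (bz (negNegOne (base.cls b)) + bz (negTwo (base.cls b)))) = 0 := Finset.sum_eq_zero fun b _ => e b
  rw [hroot] at hs
  exact one_ne_zero hs

/-- Elements of the augmented kernel at `δ = 1`: `(x + γ·1, y + γ·1)` for a virtual kernel pair `(x, y)` and `γ ∈ 𝔽₂`. -/
private theorem mem_augKernel_one_iff₅ (p : (Fin (k + 1) → ZMod 2) × (Fin (k + 1) → ZMod 2)) :
    p ∈ base.augKernel (fun _ => 1) ↔
      ∃ (x y : Fin (k + 1) → ZMod 2) (γ : ZMod 2), (x, y) ∈ base.virtualKernel ∧ p = (fun b => x b + γ, fun b => y b + γ) := by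
  constructor
  · intro hp
    obtain ⟨q, hq, γ, rfl⟩ := exists_of_mem_augKernel base (fun _ => 1) hp
    refine ⟨q.1, q.2, γ, hq, Prod.ext ?_ ?_⟩
    · funext b; simp
    · funext b; simp
  · rintro ⟨x, y, γ, hxy, rfl⟩
    have h := add_smul_mem_augKernel base (fun _ => 1) hxy γ
    have e : ((x, y) : (Fin (k + 1) → ZMod 2) × (Fin (k + 1) → ZMod 2)) + γ • ((fun _ => (1 : ZMod 2)), fun _ => (1 : ZMod 2)) =
        (fun b => x b + γ, fun b => y b + γ) := Prod.ext (funext fun b => by simp) (funext fun b => by simp)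
    rw [e] at h
    exact h

/-- **MECHANISM (h1, no prime `≡ 5 (mod 8)`).** If `(w, 0) ∈ 𝒦⁺(1)` and `⟨m + d, w⟩ = 0`, then `(0, w) ∈ 𝒦⁺(1)`.
[cite: HeathBrown1994SelmerCongruentII, Appendix (Monsky), typescript pp. 39–41] -/
theorem swap_mem_augKernel_one_inf_ker_fst_of_noFive
    (h5 : ∀ b, negTwo (base.cls b) = true → negNegOne (base.cls b) = true)
    (hroot : (∑ b, (bz (negNegOne (base.cls b)) + bz (negTwo (base.cls b)))) = 1)
    (p : (Fin (k + 1) → ZMod 2) × (Fin (k + 1) → ZMod 2))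
    (hp : p ∈ base.augKernel (fun _ => 1) ⊓ LinearMap.ker (LinearMap.snd (ZMod 2) (Fin (k + 1) → ZMod 2) (Fin (k + 1) → ZMod 2)))
    (hc : (∑ b, (bz (negNegOne (base.cls b)) + bz (negTwo (base.cls b))) * p.1 b) = 0) :
    ((0, p.1) : (Fin (k + 1) → ZMod 2) × (Fin (k + 1) → ZMod 2)) ∈
      base.augKernel (fun _ => 1) ⊓ LinearMap.ker (LinearMap.fst (ZMod 2) (Fin (k + 1) → ZMod 2) (Fin (k + 1) → ZMod 2)) := by
  have h2 : ∀ x : ZMod 2, x + x = 0 := by decide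
  obtain ⟨hpW, hp0⟩ := Submodule.mem_inf.1 hp
  obtain ⟨x, y, γ, hxy, rfl⟩ := (mem_augKernel_one_iff₅ base p).1 hpW
  rw [LinearMap.mem_ker, LinearMap.snd_apply] at hp0
  have hy : ∀ b, y b = γ := fun b => by
    have := congrFun hp0 b
    simp only [Pi.zero_apply] at this
    linear_combination this - h2 γ
  simp only at hc ⊢
  obtain ⟨hE1, hE2⟩ := (mem_virtualKernel_iff base (x, y)).1 hxy
  -- the kernel equations of `(x, γ·1)`: `x|_M = 0`, `(Lx)_i = d_i γ`
  have hmx : ∀ i, bz (negNegOne (base.cls i)) * x i = 0 := fun i => by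
    have e := hE2 i
    simp only [hy, lap_const, add_zero] at e
    exact e
  have e1 : ∀ i, (∑ j, bz (base.neg i j) * (x j + x i)) + bz (negTwo (base.cls i)) * γ = 0 := fun i => by
    have e := hE1 i
    simp only [hy, hmx, add_zero] at e
    exact e
  -- no prime `≡ 5 (mod 8)`: `x|_D = 0`
  have hdx : ∀ i, bz (negTwo (base.cls i)) * x i = 0 := fun i => by
    cases hi : negTwo (base.cls i) with
    | false => exact zero_mul _
    | true =>
      have := hmx i
      rw [h5 i hi] at this
      exact this
  -- `⟨m + d, x + γ·1⟩ = γ·Σ_b (m_b + d_b) = γ`, so `γ = 0`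
  have hγ : γ = 0 := by
    have hs : (∑ b, (bz (negNegOne (base.cls b)) + bz (negTwo (base.cls b))) * (x b + γ)) =
        γ * ∑ b, (bz (negNegOne (base.cls b)) + bz (negTwo (base.cls b))) := by
      rw [Finset.mul_sum]
      exact Finset.sum_congr rfl fun b _ => by linear_combination hmx b + hdx b
    rw [hs, hroot, mul_one] at hc
    exact hc
  have hlap : ∀ i, (∑ j, bz (base.neg i j) * (x j + x i)) = 0 := fun i => by
    have e := e1 i
    rw [hγ, mul_zero, add_zero] at e
    exact e
  -- `(0, x) ∈ 𝒦 ⊆ 𝒦⁺(1)`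
  have h0x : ((0 : Fin (k + 1) → ZMod 2), x) ∈ base.virtualKernel := by
    rw [mem_virtualKernel_iff]
    refine ⟨fun i => ?_, fun i => ?_⟩
    · simp only [Pi.zero_apply, add_zero, mul_zero, Finset.sum_const_zero, zero_add]
      exact hdx i
    · simp only [Pi.zero_apply, mul_zero, zero_add]
      exact hlap i
  have hw : (fun b => x b + γ) = x := funext fun b => by rw [hγ, add_zero]
  rw [hw]
  refine Submodule.mem_inf.2 ⟨?_, by rw [LinearMap.mem_ker, LinearMap.fst_apply]⟩
  rw [mem_augKernel_one_iff₅]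
  exact ⟨0, x, 0, h0x, Prod.ext (funext fun b => by simp) (funext fun b => by simp)⟩

/-- ★★ **No «κ_u + ε» exceptional odd base without a prime `≡ 5 (mod 8)`**: `2 · dim (𝒦⁺(1) ∩ V×0) ≤ dim 𝒦 + 1` (`= 2τ₀` by
`odd_finrank_virtualKernel`). [cite: HeathBrown1994SelmerCongruentII, Appendix (Monsky), typescript pp. 39–41] -/
theorem two_mul_finrank_augKernel_one_inf_ker_snd_le_of_noFive
    (h5 : ∀ b, negTwo (base.cls b) = true → negNegOne (base.cls b) = true)
    (hroot : (∑ b, (bz (negNegOne (base.cls b)) + bz (negTwo (base.cls b)))) = 1) :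
    2 * finrank (ZMod 2) ↥(base.augKernel (fun _ => 1) ⊓
        LinearMap.ker (LinearMap.snd (ZMod 2) (Fin (k + 1) → ZMod 2) (Fin (k + 1) → ZMod 2))) ≤
      finrank (ZMod 2) ↥base.virtualKernel + 1 := by
  set W := base.augKernel (fun _ => 1) with hWdef
  set C := W ⊓ LinearMap.ker (LinearMap.fst (ZMod 2) (Fin (k + 1) → ZMod 2) (Fin (k + 1) → ZMod 2)) with hC
  set A := W ⊓ LinearMap.ker (LinearMap.snd (ZMod 2) (Fin (k + 1) → ZMod 2) (Fin (k + 1) → ZMod 2)) with hA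
  obtain ⟨φc, hφc⟩ := exists_dot_dual (k := k) (fun b => bz (negNegOne (base.cls b)) + bz (negTwo (base.cls b)))
  set fc := φc.comp (LinearMap.fst (ZMod 2) (Fin (k + 1) → ZMod 2) (Fin (k + 1) → ZMod 2)) with hfc
  set A₀ := A ⊓ LinearMap.ker fc with hA₀
  set e := LinearEquiv.prodComm (ZMod 2) (Fin (k + 1) → ZMod 2) (Fin (k + 1) → ZMod 2) with he
  have hA₀C : A₀.map e.toLinearMap ≤ C := by
    intro q hq
    obtain ⟨p, hp, rfl⟩ := Submodule.mem_map.1 hq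
    obtain ⟨hpA, hpc⟩ := Submodule.mem_inf.1 hp
    have hp0 : p.2 = 0 := by
      have := (Submodule.mem_inf.1 hpA).2
      rwa [LinearMap.mem_ker, LinearMap.snd_apply] at this
    have hc : (∑ b, (bz (negNegOne (base.cls b)) + bz (negTwo (base.cls b))) * p.1 b) = 0 := by
      rw [LinearMap.mem_ker, hfc, LinearMap.comp_apply, LinearMap.fst_apply, hφc] at hpc
      exact hpc
    have hsw : e.toLinearMap p = (0, p.1) := by
      rw [LinearEquiv.coe_toLinearMap, he, LinearEquiv.prodComm_apply, Prod.swap, hp0]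
    rw [hsw]
    exact swap_mem_augKernel_one_inf_ker_fst_of_noFive base h5 hroot p hpA hc
  have hle₁ : finrank (ZMod 2) ↥(A₀.map e.toLinearMap) ≤ finrank (ZMod 2) ↥C := Submodule.finrank_mono hA₀C
  rw [← LinearEquiv.finrank_eq (Submodule.equivMapOfInjective _ e.injective A₀)] at hle₁
  have hcod₁ : finrank (ZMod 2) ↥A ≤ finrank (ZMod 2) ↥A₀ + 1 := finrank_le_finrank_inf_ker_add_one_odd₅ A fc
  have hCA : C ⊓ A = ⊥ := by
    rw [Submodule.eq_bot_iff]
    intro p hp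
    obtain ⟨hpC, hpA⟩ := Submodule.mem_inf.1 hp
    have h1 : p.1 = 0 := by
      have := (Submodule.mem_inf.1 hpC).2
      rwa [LinearMap.mem_ker, LinearMap.fst_apply] at this
    have hp2 : p.2 = 0 := by
      have := (Submodule.mem_inf.1 hpA).2
      rwa [LinearMap.mem_ker, LinearMap.snd_apply] at this
    exact Prod.ext h1 hp2
  have hsup : C ⊔ A ≤ W := sup_le inf_le_left inf_le_left
  have hW : finrank (ZMod 2) ↥W = finrank (ZMod 2) ↥base.virtualKernel + 1 :=
    finrank_augKernel_eq base (fun _ => 1) (one_one_not_mem_virtualKernel₅ base hroot)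
  have hsum := Submodule.finrank_sup_add_finrank_inf_eq C A
  rw [hCA, finrank_bot, add_zero] at hsum
  have hmono := Submodule.finrank_mono hsup
  obtain ⟨r, hr⟩ := odd_finrank_virtualKernel base hroot
  omega

/-- ★★★ **ODD DOOR AT δ = 1 for bases with no prime `≡ 5 (mod 8)` (two conditions).** For a root-number-`−1` odd base all of whose primes
`≡ ±3 (mod 8)` are `≡ 3 (mod 8)`, put `τ₀ := (dim 𝒦 + 1)/2`. If `𝒦⁺(1)` meets `0 × V` and the diagonal in dimension `≤ τ₀`, a pattern-free
Heegner recipe with `τ₀ + 1` auxiliary primes exists. [cite: HeathBrown1994SelmerCongruentII, Appendix (Monsky), typescript pp. 39–41] -/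
theorem exists_patternFree_design_one_of_noFive_odd
    (h5 : ∀ b, negTwo (base.cls b) = true → negNegOne (base.cls b) = true)
    (hroot : (∑ b, (bz (negNegOne (base.cls b)) + bz (negTwo (base.cls b)))) = 1)
    (h2 : finrank (ZMod 2) ↥(base.augKernel (fun _ => 1) ⊓
      LinearMap.ker (LinearMap.fst (ZMod 2) (Fin (k + 1) → ZMod 2) (Fin (k + 1) → ZMod 2))) ≤
        (finrank (ZMod 2) ↥base.virtualKernel + 1) / 2)
    (h3 : finrank (ZMod 2) ↥(base.augKernel (fun _ => 1) ⊓
      LinearMap.ker (LinearMap.fst (ZMod 2) (Fin (k + 1) → ZMod 2) (Fin (k + 1) → ZMod 2) +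
        LinearMap.snd (ZMod 2) (Fin (k + 1) → ZMod 2) (Fin (k + 1) → ZMod 2))) ≤
        (finrank (ZMod 2) ↥base.virtualKernel + 1) / 2) :
    ∃ (c₁ : AuxCell) (rest : List AuxCell), rest.length = (finrank (ZMod 2) ↥base.virtualKernel + 1) / 2 ∧
      heegnerK base (c₁ :: rest) = true ∧ ∀ pat : ℕ → ℕ → Bool, (dataK base (c₁ :: rest) pat).monskyOddS.det = 1 := by
  obtain ⟨r, hr⟩ := odd_finrank_virtualKernel base hroot
  have h1 : finrank (ZMod 2) ↥(base.augKernel (fun _ => 1) ⊓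
      LinearMap.ker (LinearMap.snd (ZMod 2) (Fin (k + 1) → ZMod 2) (Fin (k + 1) → ZMod 2))) ≤
        (finrank (ZMod 2) ↥base.virtualKernel + 1) / 2 := by
    have := two_mul_finrank_augKernel_one_inf_ker_snd_le_of_noFive base h5 hroot
    omega
  exact exists_patternFree_design_of_odd base hroot (fun _ => 1) (one_one_not_mem_virtualKernel₅ base hroot) h1 h2 h3

/-- ★★★ **The same through the realisation door**: for every root-number-`−1` odd base with no prime `≡ 5 (mod 8)` whose augmented kernel at
`δ = 1` meets `0 × V` and the diagonal in dimension `≤ τ₀`, one cell list `aux` (`τ₀ + 1` cells, `heegnerK`) such that any realising primes in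
the size window give the conclusion of `HeegnerTwistCouplingInSupply` at `(E_n, P₀)`, modulo Burungale–Tian.
[cite: HeathBrown1994SelmerCongruentII, Appendix (Monsky), typescript pp. 39–41] [cite: BurungaleTian2026, Thm. 1.1]
[cite: Oesterle1988Gauss, II §3 Proposition p. 57 (27)] -/
theorem exists_recipe_cruxOn_odd_one_of_noFive (hBT : burungaleTian_analyticRank_eq_zero_of_selmerCorank_eq_zero_of_hasCM)
    (h5 : ∀ b, negTwo (base.cls b) = true → negNegOne (base.cls b) = true)
    (hroot : (∑ b, (bz (negNegOne (base.cls b)) + bz (negTwo (base.cls b)))) = 1)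
    (h2 : finrank (ZMod 2) ↥(base.augKernel (fun _ => 1) ⊓
      LinearMap.ker (LinearMap.fst (ZMod 2) (Fin (k + 1) → ZMod 2) (Fin (k + 1) → ZMod 2))) ≤
        (finrank (ZMod 2) ↥base.virtualKernel + 1) / 2)
    (h3 : finrank (ZMod 2) ↥(base.augKernel (fun _ => 1) ⊓
      LinearMap.ker (LinearMap.fst (ZMod 2) (Fin (k + 1) → ZMod 2) (Fin (k + 1) → ZMod 2) +
        LinearMap.snd (ZMod 2) (Fin (k + 1) → ZMod 2) (Fin (k + 1) → ZMod 2))) ≤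
        (finrank (ZMod 2) ↥base.virtualKernel + 1) / 2) :
    ∃ aux : List AuxCell, aux.length = (finrank (ZMod 2) ↥base.virtualKernel + 1) / 2 + 1 ∧ heegnerK base aux = true ∧
      ∀ (P : Fin (k + 1) → ℕ) (q : Fin aux.length → ℕ), RealisesK base aux P q →
        ∀ (n : ℕ) [(congruentNumberCurve n).IsElliptic], (∏ b, P b) = n →
          Real.sqrt ((∏ j, q j : ℕ) : ℝ) * Real.log ((∏ j, q j : ℕ) : ℝ) < Real.pi * P 0 →
          ∃ (K : Type) (_ : Field K) (_ : NumberField K),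
            IsImaginaryQuadratic K ∧ 4 < (NumberField.discr K).natAbs ∧
            SatisfiesHeegnerHypothesis ((congruentNumberCurve n).conductorNorm ℤ) K ∧
            ((congruentNumberCurve n).quadraticTwist (NumberField.discr K : ℚ)).entireLFunction 1 ≠ 0 ∧
            ¬ P 0 ∣ NumberField.classNumber K := by
  obtain ⟨c₁, rest, hlen, hH, hdet⟩ := exists_patternFree_design_one_of_noFive_odd base h5 hroot h2 h3
  refine ⟨c₁ :: rest, by simp [hlen], hH, ?_⟩
  intro P q hR n _ hn hsize
  exact hR.cruxOn_odd_of_BT_of_forall hBT hH hdet hn hsize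

end NoFiveOdd

end Summit.BirchSwinnertonDyer.BirchSwinnertonDyer.Theorems.SymbolicMonsky
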